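import Mathlib.NumberTheory.Height.MvPolynomial
import Mathlib.NumberTheory.Height.NumberField
import HarnessLib

/-!
# The height of the `j`-invariant on the `λ`-line: `h(j(λ)) = 6·h(λ) + O([K:ℚ])`

For the Legendre curve `y² = x(x−1)(x−λ)` the `j`-invariant is
`j(λ) = 2^8·(λ² − λ + 1)³/(λ²·(λ − 1)²)` (Silverman, *The Arithmetic of Elliptic Curves*,
III.1.7), a rational function of degree `6`; hence, by the functoriality of the Weil height under
morphisms of `ℙ¹` (Silverman, AEC VIII.5.6 / Hindry–Silverman B.2.5), the logarithmic heights
satisfy `h(j(λ)) = 6·h(λ) + O(1)`.  This is the classical content of the third "equality of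
bounded discrepancy classes" `(1/6)·ht_∞ ≈ ht_{ω_X(D)}` of [IUTchIV] Corollary 2.2 (i)
(Mochizuki, *Inter-universal Teichmüller theory IV*, RIMS preprint (2020) = PRIMS **57** (2021),
Cor. 2.2 (i) p. 41: "`ht_∞` … the normalized height … determined by the pull-back to `X` of the
divisor at infinity of `(M̄_ell)_ℚ`", `X = ℙ¹_λ`, `D = {0, 1, ∞}`, `deg ω_X(D) = 1`, `deg j^*[∞] = 6`)
— node `IUTchIV:Cor2.2(i)` of the abc-iut cell, third equivalence; the BD-class statement over
the cell's [GenEll] vocabulary is derived from this file in `Literature/IUT/LogVolume/`.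

We prove it with Mathlib's height machine (M. Stoll, `Mathlib.NumberTheory.Height.*`): for every
field `K` with an admissible family of absolute values and `char K = 0`, and every `x ∈ K ∖ {0, 1}`,

  `|logHeight₁ (2^8·(x²−x+1)³/(x²(x−1)²)) − 6·logHeight₁ x| ≤ C·totalWeight K`

with an ABSOLUTE constant `C` (`exists_abs_logHeight₁_jLambda_sub_le`); for a number field
`totalWeight K = [K:ℚ]` (`NumberField.totalWeight_eq_finrank`), which is exactly the uniformity in
the field of definition that statements about BD-classes of NORMALISED heights `(1/[K:ℚ])·h_K`
over `X(ℚ̄) = ⋃_K X(K)` require (`exists_abs_logHeight₁_jLambda_sub_le_finrank`).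

## Method

* `Height.logHeight_eval_le` / `Height.logHeight_eval_ge` (upper/lower bounds for the height of the
  image under a homogeneous polynomial map, the lower one from a Nullstellensatz certificate) for
  `p = ((X₀²−X₀X₁+X₁²)³, X₀²X₁²(X₀−X₁)²)` (degree `6`) and the degree-`5` certificates
  `X₀¹¹ = (X₀⁵+3X₀⁴X₁−3X₀³X₁²)·p₀ + (6X₀⁵−8X₀⁴X₁+11X₀³X₁²−6X₀²X₁³+3X₀X₁⁴)·p₁`,
  `X₁¹¹ = (X₁⁵+3X₀X₁⁴−3X₀²X₁³)·p₀ + (3X₀⁴X₁−6X₀³X₁²+11X₀²X₁³−8X₀X₁⁴+6X₁⁵)·p₁`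
  (the resultant of `p₀, p₁` is `±1`, so integral certificates exist).
* The constants in Stoll's bounds are `log (max (mulHeightBound p) 1)`; to make them LINEAR IN
  `totalWeight K` with a `K`-independent slope we prove the uniformity lemma
  `mulHeightBound_le_pow_totalWeight`: a family that is the image of an INTEGER family `P`
  has `mulHeightBound p ≤ B^{totalWeight K}` for any `B ≥ 1` dominating the `ℓ¹`-norms of the
  coefficient vectors of the `P j` (archimedean absolute values are `≤ |·|` on `ℤ`, nonarchimedean
  ones are `≤ 1` on `ℤ`).
* The factor `2^8`: `logHeight₁ (n : K) ≤ totalWeight K · log n` (`logHeight₁_natCast_le`) and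
  `logHeight₁ (a·b) ≤ logHeight₁ a + logHeight₁ b`.

Deliberately NOT here: explicit numerical constants (only existence of an absolute constant is
proved — all that BD-classes see); heights on `M̄_ell` as a stack; anything about elliptic curves.
-/

noncomputable section

universe u

open MvPolynomial Height Height.AdmissibleAbsValues Real

namespace Literature.NumberTheory.DiophantineGeometry

/-! ## Uniform-in-the-field bounds for Stoll's height constants -/

section Uniform

variable {K : Type*} [Field K] [AdmissibleAbsValues K] {ι ι' : Type*}

omit [AdmissibleAbsValues K] in
/-- An absolute value is at most `|c|` on an integer `c` (from `v(n) ≤ n` on naturals).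
[folklore] -/
private theorem abv_intCast_le_abs (v : AbsoluteValue K ℝ) (c : ℤ) : v (c : K) ≤ |(c : ℝ)| := by
  obtain ⟨n, rfl | rfl⟩ := Int.eq_nat_or_neg c
  · simpa using v.apply_nat_le_self n
  · simpa using v.apply_nat_le_self n

/-- **Uniformity of Stoll's height-bound constant for integral polynomial maps.** If the family
`p : ι' → K[X_ι]` is the image of an integer family `P` and `B ≥ 1` bounds the `ℓ¹`-norm of the
coefficient vector of every `P j`, then `Height.mulHeightBound p ≤ B ^ totalWeight K`: the
archimedean absolute values of `K` are `≤ |·|` on `ℤ` and the nonarchimedean ones are `≤ 1` on `ℤ`.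
Consequently the constants in `Height.logHeight_eval_le` / `Height.logHeight_eval_ge` are
`≤ totalWeight K · log B`, i.e. linear in `[K:ℚ]` for number fields with a slope depending only on
the integer family. This is the local-coefficient step of the proof of Silverman, AEC
Thm. VIII.5.6 (`|F(P)|_v ≤ ε_v(N,d)·|F|_v·|P|_v^d` with `|F|_v = 1` at the nonarchimedean `v` for
integral `F`), which is what makes the `O(1)` there depend on the map only, rendered for Mathlib's
constant `Height.mulHeightBound`. [cite: SilvermanAEC2009, Thm VIII.5.6 (proof)] -/
theorem mulHeightBound_le_pow_totalWeight {p : ι' → MvPolynomial ι K}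
    (P : ι' → MvPolynomial ι ℤ) (hpP : ∀ j, p j = map (Int.castRingHom K) (P j)) {B : ℝ}
    (hB₁ : 1 ≤ B) (hB : ∀ j, ∑ s ∈ (P j).support, |((coeff s (P j) : ℤ) : ℝ)| ≤ B) :
    mulHeightBound p ≤ B ^ totalWeight K := by
  classical
  have hB₀ : 0 ≤ B := zero_le_one.trans hB₁
  have hcoeff : ∀ j s, coeff s (p j) = ((coeff s (P j) : ℤ) : K) := fun j s => by
    rw [hpP, coeff_map, eq_intCast]
  have hsupp : ∀ j, (p j).support ⊆ (P j).support := fun j => by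
    rw [hpP]; exact support_map_subset _ _
  -- archimedean factor: each `v`-term is `≤ B`
  have harch_term : ∀ v : AbsoluteValue K ℝ,
      (⨆ j, (AddMonoidAlgebra.coeff <| p j).sum fun _ c ↦ v c) ≤ B := fun v => by
    refine Real.iSup_le (fun j => ?_) hB₀
    change ∑ s ∈ (p j).support, v (coeff s (p j)) ≤ B
    calc ∑ s ∈ (p j).support, v (coeff s (p j))
        ≤ ∑ s ∈ (P j).support, v (coeff s (p j)) :=
          Finset.sum_le_sum_of_subset_of_nonneg (hsupp j) fun _ _ _ => v.nonneg _
      _ ≤ ∑ s ∈ (P j).support, |((coeff s (P j) : ℤ) : ℝ)| :=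
          Finset.sum_le_sum fun s _ => by rw [hcoeff]; exact abv_intCast_le_abs v _
      _ ≤ B := hB j
  have harch_nonneg : ∀ v : AbsoluteValue K ℝ,
      0 ≤ ⨆ j, (AddMonoidAlgebra.coeff <| p j).sum fun _ c ↦ v c := fun v =>
    Real.iSup_nonneg fun j => Finsupp.sum_nonneg' fun _ => v.nonneg _
  have harch : (archAbsVal.map fun v ↦ ⨆ j, (AddMonoidAlgebra.coeff <| p j).sum fun _ c ↦ v c).prod
      ≤ B ^ totalWeight K := by
    calc _ ≤ ((archAbsVal (K := K)).map fun _ ↦ B).prod :=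
          Multiset.prod_map_le_prod_map₀ _ _ (fun v _ => harch_nonneg v) fun v _ => harch_term v
      _ = B ^ totalWeight K := by rw [Multiset.map_const', Multiset.prod_replicate]; rfl
  -- nonarchimedean factor: each `v`-term is in `[0, 1]`
  have hnon_term : ∀ v : nonarchAbsVal (K := K),
      0 ≤ (⨆ j, max (⨆ s : (p j).support, v.val (coeff s (p j))) 1) ∧
        (⨆ j, max (⨆ s : (p j).support, v.val (coeff s (p j))) 1) ≤ 1 := fun v => by
    refine ⟨Real.iSup_nonneg fun j => le_max_of_le_right zero_le_one,
      Real.iSup_le (fun j => max_le (Real.iSup_le (fun s => ?_) zero_le_one) le_rfl) zero_le_one⟩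
    rw [hcoeff]
    exact (isNonarchimedean _ v.prop).apply_intCast_le_one
  have hnon : (∏ᶠ v : nonarchAbsVal (K := K),
      ⨆ j, max (⨆ s : (p j).support, v.val (coeff s (p j))) 1) ≤ 1 := by
    refine (finprod_induction (fun x : ℝ => 0 ≤ x ∧ x ≤ 1) ⟨zero_le_one, le_rfl⟩
      (fun x y hx hy => ⟨mul_nonneg hx.1 hy.1, mul_le_one₀ hx.2 hy.1 hy.2⟩) hnon_term).2
  have hnon₀ : 0 ≤ (∏ᶠ v : nonarchAbsVal (K := K),
      ⨆ j, max (⨆ s : (p j).support, v.val (coeff s (p j))) 1) :=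
    finprod_nonneg fun v => (hnon_term v).1
  rw [mulHeightBound_eq]
  calc _ ≤ B ^ totalWeight K * 1 := mul_le_mul harch hnon hnon₀ (pow_nonneg hB₀ _)
    _ = B ^ totalWeight K := mul_one _

/-- The height of a natural number: `mulHeight₁ (n : K) ≤ n ^ totalWeight K` for `n ≥ 1`
(archimedean absolute values of `n` are `≤ n`, nonarchimedean ones `≤ 1`; equality holds for
number fields). [folklore] -/
private theorem mulHeight₁_natCast_le (n : ℕ) (hn : 1 ≤ n) : mulHeight₁ (n : K) ≤ (n : ℝ) ^ totalWeight K := by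
  have hn' : (1 : ℝ) ≤ n := by exact_mod_cast hn
  have harch : ((archAbsVal (K := K)).map fun v ↦ max (v (n : K)) 1).prod ≤ (n : ℝ) ^ totalWeight K := by
    calc _ ≤ ((archAbsVal (K := K)).map fun _ ↦ (n : ℝ)).prod :=
          Multiset.prod_map_le_prod_map₀ _ _ (fun v _ => le_max_of_le_right zero_le_one)
            fun v _ => max_le (v.apply_nat_le_self n) hn'
      _ = (n : ℝ) ^ totalWeight K := by rw [Multiset.map_const', Multiset.prod_replicate]; rfl
  have hnon_term : ∀ v : nonarchAbsVal (K := K), max (v.val (n : K)) 1 = 1 := fun v =>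
    max_eq_right (isNonarchimedean _ v.prop).apply_natCast_le_one
  rw [mulHeight₁_eq, finprod_eq_one_of_forall_eq_one hnon_term, mul_one]
  exact harch

/-- The logarithmic height of a natural number: `logHeight₁ (n : K) ≤ totalWeight K · log n`.
[folklore] -/
private theorem logHeight₁_natCast_le (n : ℕ) : logHeight₁ (n : K) ≤ totalWeight K * Real.log n := by
  rcases Nat.eq_zero_or_pos n with rfl | hn
  · simp [logHeight₁_zero]
  rw [logHeight₁_eq_log_mulHeight₁, ← Real.log_pow]
  exact Real.log_le_log (mulHeight₁_pos _) (mulHeight₁_natCast_le n hn)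

end Uniform

/-! ## The `λ`-line: `h(j(λ))` versus `6·h(λ)` -/

/-- **`h(j(λ)) = 6·h(λ) + O(totalWeight K)`, uniformly in the field.** There is an absolute
constant `C` such that for every field `K` of characteristic `0` with an admissible family of
absolute values and every `x ∈ K`, `x ≠ 0, 1`:
`|logHeight₁ (2^8(x²−x+1)³/(x²(x−1)²)) − 6·logHeight₁ x| ≤ C · totalWeight K`.
(Functoriality of the Weil height under the degree-`6` morphism `j : ℙ¹_λ → ℙ¹_j`, an instance of
Silverman, AEC Thm. VIII.5.6; used in [IUTchIV] Cor. 2.2 (i) p. 41 as `(1/6)·ht_∞ ≈ ht_{ω_X(D)}` —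
abc-iut node `IUTchIV:Cor2.2(i)`, third equivalence.) [cite: SilvermanAEC2009, Thm VIII.5.6] -/
theorem exists_abs_logHeight₁_jLambda_sub_le :
    ∃ C : ℝ, ∀ (K : Type u) [Field K] [AdmissibleAbsValues K] [CharZero K] (x : K),
      x ≠ 0 → x ≠ 1 →
        |logHeight₁ (2 ^ 8 * (x ^ 2 - x + 1) ^ 3 / (x ^ 2 * (x - 1) ^ 2)) - 6 * logHeight₁ x|
          ≤ C * totalWeight K := by
  classical
  -- the integer data: the map `p` and the Nullstellensatz certificates `q`
  let P : Fin 2 → MvPolynomial (Fin 2) ℤ :=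
    ![(X 0 ^ 2 - X 0 * X 1 + X 1 ^ 2) ^ 3, X 0 ^ 2 * X 1 ^ 2 * (X 0 - X 1) ^ 2]
  let Q : Fin 2 × Fin 2 → MvPolynomial (Fin 2) ℤ :=
    ![![C 1 * X 0 ^ 5 * X 1 ^ 0 + C 3 * X 0 ^ 4 * X 1 ^ 1 - C 3 * X 0 ^ 3 * X 1 ^ 2,
        C 6 * X 0 ^ 5 * X 1 ^ 0 - C 8 * X 0 ^ 4 * X 1 ^ 1 + C 11 * X 0 ^ 3 * X 1 ^ 2
          - C 6 * X 0 ^ 2 * X 1 ^ 3 + C 3 * X 0 ^ 1 * X 1 ^ 4],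
      ![C 1 * X 0 ^ 0 * X 1 ^ 5 + C 3 * X 0 ^ 1 * X 1 ^ 4 - C 3 * X 0 ^ 2 * X 1 ^ 3,
        C 3 * X 0 ^ 4 * X 1 ^ 1 - C 6 * X 0 ^ 3 * X 1 ^ 2 + C 11 * X 0 ^ 2 * X 1 ^ 3
          - C 8 * X 0 ^ 1 * X 1 ^ 4 + C 6 * X 0 ^ 0 * X 1 ^ 5]].uncurry
  -- `ℓ¹`-bounds of the coefficient vectors (any common bound will do)
  let BP : ℝ := max 1 (⨆ j, ∑ s ∈ (P j).support, |((coeff s (P j) : ℤ) : ℝ)|)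
  let BQ : ℝ := max 1 (⨆ a, ∑ s ∈ (Q a).support, |((coeff s (Q a) : ℤ) : ℝ)|)
  have hBP₁ : 1 ≤ BP := le_max_left _ _
  have hBQ₁ : 1 ≤ BQ := le_max_left _ _
  have hBP : ∀ j, ∑ s ∈ (P j).support, |((coeff s (P j) : ℤ) : ℝ)| ≤ BP := fun j =>
    (le_ciSup (f := fun j => ∑ s ∈ (P j).support, |((coeff s (P j) : ℤ) : ℝ)|)
      (Finite.bddAbove_range _) j).trans (le_max_right _ _)
  have hBQ : ∀ a, ∑ s ∈ (Q a).support, |((coeff s (Q a) : ℤ) : ℝ)| ≤ BQ := fun a =>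
    (le_ciSup (f := fun a => ∑ s ∈ (Q a).support, |((coeff s (Q a) : ℤ) : ℝ)|)
      (Finite.bddAbove_range _) a).trans (le_max_right _ _)
  refine ⟨Real.log BP + (Real.log 2 + Real.log BQ) + Real.log 256, fun K _ _ _ x hx0 hx1 => ?_⟩
  -- the families over `K`
  let p : Fin 2 → MvPolynomial (Fin 2) K := fun j => map (Int.castRingHom K) (P j)
  let q : Fin 2 × Fin 2 → MvPolynomial (Fin 2) K := fun a => map (Int.castRingHom K) (Q a)
  have hP : ∀ j, (P j).IsHomogeneous 6 := by
    intro j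
    fin_cases j
    · exact (((isHomogeneous_X_pow (R := ℤ) (0 : Fin 2) 2).sub
        ((isHomogeneous_X ℤ 0).mul (isHomogeneous_X ℤ 1))).add (isHomogeneous_X_pow 1 2)).pow 3
    · exact ((isHomogeneous_X_pow (R := ℤ) (0 : Fin 2) 2).mul (isHomogeneous_X_pow 1 2)).mul
        (((isHomogeneous_X ℤ 0).sub (isHomogeneous_X ℤ 1)).pow 2)
  have hterm : ∀ (c : ℤ) (i j : ℕ),
      (C c * X 0 ^ i * X 1 ^ j : MvPolynomial (Fin 2) ℤ).IsHomogeneous (i + j) :=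
    fun c i j => (isHomogeneous_C_mul_X_pow c 0 i).mul (isHomogeneous_X_pow 1 j)
  have hQ : ∀ a, (Q a).IsHomogeneous 5 := by
    rintro ⟨i, j⟩
    fin_cases i <;> fin_cases j
    · exact ((hterm 1 5 0).add (hterm 3 4 1)).sub (hterm 3 3 2)
    · exact ((((hterm 6 5 0).sub (hterm 8 4 1)).add (hterm 11 3 2)).sub (hterm 6 2 3)).add
        (hterm 3 1 4)
    · exact ((hterm 1 0 5).add (hterm 3 1 4)).sub (hterm 3 2 3)
    · exact ((((hterm 3 4 1).sub (hterm 6 3 2)).add (hterm 11 2 3)).sub (hterm 8 1 4)).add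
        (hterm 6 0 5)
  have hp : ∀ j, (p j).IsHomogeneous 6 := fun j => (hP j).map _
  have hq : ∀ a, (q a).IsHomogeneous 5 := fun a => (hQ a).map _
  -- the point of `ℙ¹` and the values of `p` there
  set a : K := (x ^ 2 - x + 1) ^ 3 with ha
  set b : K := x ^ 2 * (x - 1) ^ 2 with hb
  have hb0 : b ≠ 0 := by
    rw [hb]; exact mul_ne_zero (pow_ne_zero _ hx0) (pow_ne_zero _ (sub_ne_zero.mpr hx1))
  let y : Fin 2 → K := ![x, 1]
  have heval : (fun j => (p j).eval y) = ![a, b] := by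
    funext j
    fin_cases j
    · simp [p, P, y, ha]
    · simp [p, P, y, hb]
  have hcert : ∀ k, ∑ j, (q (k, j)).eval y * (p j).eval y = y k ^ (5 + 6) := by
    intro k
    fin_cases k <;> simp [p, q, P, Q, y, Fin.sum_univ_two] <;> ring
  -- Stoll's bounds with uniform constants
  have h256 : (256 : K) ≠ 0 := by norm_num
  have hx' : logHeight y = logHeight₁ x := (logHeight₁_eq_logHeight x).symm
  have hup : logHeight ![a, b] ≤ totalWeight K * Real.log BP + 6 * logHeight₁ x := by
    have h := logHeight_eval_le hp y
    rw [heval, hx'] at h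
    push_cast at h
    have hmhb := mulHeightBound_le_pow_totalWeight P (fun j => rfl) hBP₁ hBP (p := p)
    have hlog : Real.log (max (mulHeightBound p) 1) ≤ totalWeight K * Real.log BP :=
      calc Real.log (max (mulHeightBound p) 1) ≤ Real.log (BP ^ totalWeight K) :=
            Real.log_le_log (by positivity) (max_le hmhb (one_le_pow₀ hBP₁))
        _ = totalWeight K * Real.log BP := Real.log_pow _ _
    linarith
  have hlow : 6 * logHeight₁ x - totalWeight K * (Real.log 2 + Real.log BQ) ≤ logHeight ![a, b] := by
    have h := logHeight_eval_ge hq p hcert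
    rw [heval, hx'] at h
    refine le_trans ?_ h
    have hmhb := mulHeightBound_le_pow_totalWeight Q (fun a => rfl) hBQ₁ hBQ (p := q)
    have hcard : (Nat.card (Fin 2) : ℝ) = 2 := by simp
    have : Real.log (Nat.card (Fin 2) ^ totalWeight K * max (mulHeightBound q) 1)
        ≤ totalWeight K * (Real.log 2 + Real.log BQ) := by
      rw [hcard]
      calc Real.log (2 ^ totalWeight K * max (mulHeightBound q) 1)
          ≤ Real.log (2 ^ totalWeight K * BQ ^ totalWeight K) :=
            Real.log_le_log (by positivity)
              (mul_le_mul_of_nonneg_left (max_le hmhb (one_le_pow₀ hBQ₁)) (by positivity))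
        _ = totalWeight K * (Real.log 2 + Real.log BQ) := by
            rw [Real.log_mul (by positivity) (by positivity), Real.log_pow, Real.log_pow]; ring
    push_cast at this ⊢
    linarith
  -- the factor `2^8`
  have hj : (2 : K) ^ 8 * (x ^ 2 - x + 1) ^ 3 / (x ^ 2 * (x - 1) ^ 2) = (256 : K) * (a / b) := by
    rw [ha, hb]; ring
  have h256h : logHeight₁ (256 : K) ≤ totalWeight K * Real.log 256 := by
    exact_mod_cast logHeight₁_natCast_le (K := K) 256
  have hab : logHeight₁ (a / b) = logHeight ![a, b] := logHeight₁_div_eq_logHeight a b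
  have hj_up : logHeight₁ ((256 : K) * (a / b)) ≤ logHeight₁ (256 : K) + logHeight ![a, b] := by
    rw [← hab]; exact logHeight₁_mul_le _ _
  have hj_low : logHeight ![a, b] ≤ logHeight₁ (256 : K) + logHeight₁ ((256 : K) * (a / b)) := by
    have : a / b = (256 : K)⁻¹ * ((256 : K) * (a / b)) := by
      rw [← mul_assoc, inv_mul_cancel₀ h256, one_mul]
    rw [← hab]
    conv_lhs => rw [this]
    exact (logHeight₁_mul_le _ _).trans (by rw [logHeight₁_inv])
  rw [hj, abs_le]
  have htw : (0 : ℝ) ≤ totalWeight K := Nat.cast_nonneg _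
  have hl2 : 0 ≤ Real.log 2 := Real.log_nonneg one_le_two
  have hlP : 0 ≤ Real.log BP := Real.log_nonneg hBP₁
  have hlQ : 0 ≤ Real.log BQ := Real.log_nonneg hBQ₁
  have hl256 : 0 ≤ Real.log 256 := Real.log_nonneg (by norm_num)
  constructor <;> nlinarith

/-- **Number-field form** (the one BD-classes use): an absolute constant `C` with
`|h_K(j(x)) − 6·h_K(x)| ≤ C·[K:ℚ]` for every number field `K` and `x ∈ K ∖ {0, 1}`, where
`h_K = logHeight₁` is the height relative to `K` and `j(x) = 2^8(x²−x+1)³/(x²(x−1)²)`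
(abc-iut node `IUTchIV:Cor2.2(i)`, third equivalence, field-uniform form).
[cite: SilvermanAEC2009, Thm VIII.5.6] -/
theorem exists_abs_logHeight₁_jLambda_sub_le_finrank :
    ∃ C : ℝ, ∀ (K : Type) [Field K] [NumberField K] (x : K), x ≠ 0 → x ≠ 1 →
      |logHeight₁ (2 ^ 8 * (x ^ 2 - x + 1) ^ 3 / (x ^ 2 * (x - 1) ^ 2)) - 6 * logHeight₁ x|
        ≤ C * Module.finrank ℚ K := by
  obtain ⟨C, hC⟩ := exists_abs_logHeight₁_jLambda_sub_le.{0}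
  refine ⟨C, fun K _ _ x hx0 hx1 => ?_⟩
  rw [← NumberField.totalWeight_eq_finrank]
  exact hC K x hx0 hx1

end Literature.NumberTheory.DiophantineGeometry

end
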